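import Summits.QuantumFields.YangMills.Theorems.RenyiTelescopePlaquetteTransport

/-!
# Route `RenyiTelescope` — glue item `HistoryTailOfRenyiTelescope` (stmt-QuantumFields-27139): THE INTERIOR COMPLEMENT
# (support file; ideator seat `ym-r3-idea-2` g3, registered stub `stub_interiorComplement` of the glue skeleton v5)

THE STEP (G2 of the glue plan attached to the item).  The Rényi telescope of the line conditions on the interior event
`Int_J = histGoodInt F θ_(b₀) (θ_c 1) J 1` and needs its Gibbs mass bounded BELOW.  This file proves the constant-free, crux-free
decomposition of its complement (`stub_interiorComplement`): for any family `F` (in the glue: a refinement `F.refine d`) at `0 < γ ≤ 1`,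
`0 < b₀`, `c ≤ 1`, `J ≥ 1`,
  `1 − Gibbs_J(Int_J) ≤ Gibbs_J{¬PlaqSmall θ_c(J) U} + Σ_(1 ≤ j < J) Σ_(p') Gibbs^(F.refine (J−j))_j ((unitA)⁻¹{θ'_c(0) ≤ |V(∂p')−1|} ∩ Int'_j)`,
i.e. the interior complement is the BARE finest-lattice large-field event plus, level by level, unit events OF THE SAME KIND for the deeper
refinements `F.refine (J − j)` at the smaller cut-offs `j` (coupling `γL^(−(J−j))`).  Proof: `Int_J ⊇ histGood F θ_c J 1` (all heights `≥ 1`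
`c`-good ⇒ interior; tree `T3InteriorExcision.histGood_subset_histGoodInt` with `θ_c ≤ θ_(b₀)`, `θBal_scaled_le`); the complement of the
latter is decomposed by the finest `c`-bad level (`HistoryTailOfTwoSided.real_compl_histGood_le_sum_finestBad`, `n = 1`); the level-`0`
piece is inside the bare event (`Averaging.iter _ 0 = id`); each piece at a level `j ≥ 1` is transported to `F.refine (J − j)` by the landed
`stub_plaquetteTransport` (run `J = j + (J − j)`).

WHAT THIS IS NOT: no probability is estimated (the right-hand side is bounded in the glue by the bare tail `bareTailAt` and, inductively, by the
unit-event tails — the abstract bootstrap `stub_abstractBootstrap`); the cruxes are untouched; nothing here bears on the Yang–Mills mass gap and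
the rung R3 (`YM3TorusSU2`) is NOT proved.

References: T. Bałaban, CMP 102 (1985) 255–275 [Balaban1985UV3] ((7) p.257: decomposition of unity by the first large scale; (60) p.270:
restrictions `Z(B(M^j(U'|_(Ω_j))))`).
-/

noncomputable section

open MeasureTheory
open Literature.MathematicalPhysics.QuantumFieldTheory.Balaban1983to89
open Literature.MathematicalPhysics.QuantumFieldTheory.Balaban1983to89.T3ContinuumYM3Torus
open Literature.MathematicalPhysics.QuantumFieldTheory.Balaban1983to89.T3UnitScaleTilt
open Literature.MathematicalPhysics.QuantumFieldTheory.Balaban1983to89.T3UnitLawDensityEML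
open Literature.MathematicalPhysics.QuantumFieldTheory.Balaban1983to89.T3InteriorExcision
open Literature.MathematicalPhysics.QuantumFieldTheory.Balaban1983to89.T3LevelShift
open Summit.QuantumFields.YangMills.Theorems.HistoryTailOfTwoSided

namespace Summit.QuantumFields.YangMills.Theorems.RenyiTelescope

/-! ## §1 One level `j ≥ 1` of run `J`: transport to `F.refine (J − j)` -/

/-- The finest-`c`-bad piece at level `1 ≤ j ≤ J` of run `J` is bounded by the unit events of `F.refine (J − j)` at cut-off `j`
(the landed `stub_plaquetteTransport`, run `J = j + (J − j)`). [cite: Balaban1985UV3, (7) p.257] -/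
theorem finestBad_piece_le_refine (F : T3Family) {γ b₀ c : ℝ} (p₀ : ℝ) (hγ : 0 < γ) (hγ1 : γ ≤ 1) (hb₀ : 0 < b₀) (hc1 : c ≤ 1)
    {J j : ℕ} (hj : 1 ≤ j) (hjJ : j ≤ J) :
    (gibbsK F ℰp γ J).real
        ({U | ¬ PlaqSmall (θBal F.L γ (c * b₀) p₀ (J - j))
            (Averaging.iter (fun i => BlockAveraging.blockAvg (P := F.P J) (j := i) ℰp) j U)} ∩
          {U | ∀ i, i < j → PlaqSmall (θBal F.L γ (c * b₀) p₀ (J - i))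
            (Averaging.iter (fun i' => BlockAveraging.blockAvg (P := F.P J) (j := i') ℰp) i U)}) ≤
      ∑ p : Plaq ((F.refine (J - j)).P 0) 0,
        (gibbsK (F.refine (J - j)) ℰp (γ * ((F.L : ℝ)⁻¹) ^ (J - j)) j).real
          ((unitA (F.refine (J - j)) ℰp j) ⁻¹'
              {V | θBal F.L (γ * ((F.L : ℝ)⁻¹) ^ (J - j)) (c * b₀) p₀ 0 ≤ GaugeGroup.dist1 (GaugeField.plaqHol V p)} ∩
            histGoodInt (F.refine (J - j)) (θBal F.L (γ * ((F.L : ℝ)⁻¹) ^ (J - j)) b₀ p₀)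
              (θBal F.L (γ * ((F.L : ℝ)⁻¹) ^ (J - j)) (c * b₀) p₀ 1) j 1) := by
  obtain ⟨h, rfl⟩ : ∃ h, J = j + h := ⟨J - j, by omega⟩
  have key := stub_plaquetteTransport F γ b₀ c p₀ h j hγ hγ1 hb₀ hc1 hj
  have e : j + h - j = h := Nat.add_sub_cancel_left ..
  rw [e] at key ⊢
  exact key

/-! ## §2 The registered stub -/

/-- **REGISTERED STUB `stub_interiorComplement` OF THE GLUE SKELETON v5 (item stmt-QuantumFields-27139)**: the complement of the interior
event of run `J ≥ 1` has Gibbs mass at most the bare finest-lattice large-field mass at threshold `θ_c(J)` plus the unit-event masses of the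
deeper refinements `F.refine (J − j)` at the cut-offs `1 ≤ j < J`. [cite: Balaban1985UV3, (7) p.257 and (60) p.270] -/
theorem stub_interiorComplement : ∀ (F : T3Family) (γ b₀ c p₀ : ℝ) (J : ℕ), 0 < γ → γ ≤ 1 → 0 < b₀ → c ≤ 1 → 1 ≤ J →
    1 - (gibbsK F ℰp γ J).real (histGoodInt F (θBal F.L γ b₀ p₀) (θBal F.L γ (c * b₀) p₀ 1) J 1) ≤
      (gibbsK F ℰp γ J).real {U | ¬ PlaqSmall (θBal F.L γ (c * b₀) p₀ J) U} +
        ∑ j ∈ Finset.Ico 1 J, ∑ p : Plaq ((F.refine (J - j)).P 0) 0,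
          (gibbsK (F.refine (J - j)) ℰp (γ * ((F.L : ℝ)⁻¹) ^ (J - j)) j).real
            ((unitA (F.refine (J - j)) ℰp j) ⁻¹'
                {V | θBal F.L (γ * ((F.L : ℝ)⁻¹) ^ (J - j)) (c * b₀) p₀ 0 ≤ GaugeGroup.dist1 (GaugeField.plaqHol V p)} ∩
              histGoodInt (F.refine (J - j)) (θBal F.L (γ * ((F.L : ℝ)⁻¹) ^ (J - j)) b₀ p₀)
                (θBal F.L (γ * ((F.L : ℝ)⁻¹) ^ (J - j)) (c * b₀) p₀ 1) j 1) := by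
  intro F γ b₀ c p₀ J hγ hγ1 hb₀ hc1 hJ
  haveI := isProbabilityMeasure_gibbsK F ℰp hγ.le J
  set μ := gibbsK F ℰp γ J with hμ
  have hL : 1 ≤ F.L := F.hL.2.le
  -- `Int_J ⊇ histGood F θ_c J 1`
  have hsub : histGood F ℰp (θBal F.L γ (c * b₀) p₀) J 1 ⊆
      histGoodInt F (θBal F.L γ b₀ p₀) (θBal F.L γ (c * b₀) p₀ 1) J 1 :=
    histGood_subset_histGoodInt F (fun i => θBal_scaled_le hL hγ hγ1 hb₀ hc1 p₀ i) hJ le_rfl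
  have hmeas : MeasurableSet (histGoodInt F (θBal F.L γ b₀ p₀) (θBal F.L γ (c * b₀) p₀ 1) J 1) :=
    measurableSet_histGoodInt F _ _ J 1
  have h1 : 1 - μ.real (histGoodInt F (θBal F.L γ b₀ p₀) (θBal F.L γ (c * b₀) p₀ 1) J 1) =
      μ.real (histGoodInt F (θBal F.L γ b₀ p₀) (θBal F.L γ (c * b₀) p₀ 1) J 1)ᶜ := by
    rw [measureReal_compl hmeas, probReal_univ]
  rw [h1]
  -- the finest-`c`-bad decomposition of the complement of `histGood F θ_c J 1`
  have h2 : μ.real (histGoodInt F (θBal F.L γ b₀ p₀) (θBal F.L γ (c * b₀) p₀ 1) J 1)ᶜ ≤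
      μ.real (histGood F ℰp (θBal F.L γ (c * b₀) p₀) J 1)ᶜ :=
    measureReal_mono (Set.compl_subset_compl.mpr hsub) (measure_ne_top _ _)
  have h3 := real_compl_histGood_le_sum_finestBad F ℰp (θBal F.L γ (c * b₀) p₀) J 1 μ
  rw [Nat.sub_add_cancel hJ, Finset.range_eq_Ico, Finset.sum_eq_sum_Ico_succ_bot (by omega : 0 < J)] at h3
  refine h2.trans (h3.trans (add_le_add ?_ (Finset.sum_le_sum fun j hj => ?_)))
  · -- level `0`: the bare finest-lattice event
    refine measureReal_mono (fun U hU => ?_) (measure_ne_top _ _)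
    have hU1 := hU.1
    simp only [Set.mem_setOf_eq, Nat.sub_zero] at hU1 ⊢
    exact hU1
  · -- level `1 ≤ j < J`: transport to `F.refine (J - j)`
    rw [Finset.mem_Ico] at hj
    exact finestBad_piece_le_refine F p₀ hγ hγ1 hb₀ hc1 hj.1 hj.2.le

end Summit.QuantumFields.YangMills.Theorems.RenyiTelescope

end
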